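import Summits.Ventures.QEC.Census.CertScan
import HarnessLib

/-!
# Information-set lower-bound certificates for CSS distance, I: the checker words
# (plan/PARTITION.md v2.2 item 07.IS; CERT-FORMAT v1 §5.3 `bz` with ONE block, ONE systematic matrix, NO labels)

The brute-force replay of `Census/CertScan.lean` visits every support of weight `≤ d − 1` (`1.5 · 10⁷` per side for
the bivariate-bicycle `[[72,12,6]]` code). When the classical code `ker H` (H = the syndrome matrix of the side) has
NO nonzero word of weight `≤ d − 1` at all — true for `[[72,12,6]]`, whose allow-lists are empty — a much smaller
replay certifies the same lower bound: bring `H` to reduced row-echelon form (`r` pivot columns, `n − r` free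
columns), take the standard kernel basis `γ_j = e_j + Σ_i ρ_i[j] e_{p_i}` (`j` free, `ρ_i` the reduced rows, `p_i`
the pivots), and check that every XOR of between `1` and `d − 1` basis vectors has weight `≥ d`. Soundness
(`Census/CertInfoSetSound.lean`): a kernel vector equals the XOR of the basis vectors indexed by its FREE support,
whose size is at most its weight. For `[[72,12,6]]`: `974 981` XORs of `72`-bit words per side instead of
`1.5 · 10⁷` supports (qec-search-7 EFFICIENCY D2, 2026-08-26).

This file holds the executable words (pure structural `List`/`Nat` recursion, kernel-evaluable by
`decide +kernel`) and their elementary semantics: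

* `clb`, `hasBits k x` ("`x` has at least `k` set bits", by clearing the lowest set bit `k` times — `Nat.sub` and
  `Nat.land` are GMP-accelerated in the kernel) with `le_popc_of_hasBits`; `hasBits6` = `hasBits 6` unrolled;
* `dfs test gens b acc` — include/skip enumeration of all XORs `acc ⊕ ⨁ S`, `S` a sub-list of `gens` with
  `1 ≤ |S| ≤ b + 1`, with `dfs_sublist` (completeness) and the first-generator chunking `ichunk` /
  `dreaches_of_ichunks` (one kernel evaluation per chunk, CERT-FORMAT §7);
* the RREF certificate words: `pivotsOK` (pivot columns of the reduced rows are the unit vectors, read through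
  `colMask`), `combOK` (each reduced row is an explicit XOR of rows of `H`), `pivSelIdx` / `pivPart` / `kerVec` /
  `freeIdx` / `kerBasis` (the standard kernel basis as words), and the one-line side check `infoSetLowerOK`.

No code-specific content; no `decide` is run here; axioms ⊆ {propext, Classical.choice, Quot.sound}.
-/

namespace Summit.Ventures.QEC.Census

open Finset

/-! ## Bit counting by clearing the lowest set bit -/

/-- Clear the lowest set bit: `x &&& (x − 1)`. (definition) -/
def clb (x : ℕ) : ℕ := x &&& (x - 1)

/-- `hasBits k x`: `x` has at least `k` set bits — `k` rounds of "nonzero, then clear the lowest set bit".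
(definition, structural on `k`) -/
def hasBits : ℕ → ℕ → Bool
  | 0, _ => true
  | k + 1, x => !(x == 0) && hasBits k (clb x)

section HasBits

/-- A set bit of `clb x` is a set bit of `x`. -/
theorem testBit_of_testBit_clb {x i : ℕ} (h : (clb x).testBit i = true) : x.testBit i = true := by
  rw [clb, Nat.testBit_and, Bool.and_eq_true] at h
  exact h.1

/-- The lowest set bit of `x ≠ 0` is cleared in `clb x`: if bit `k` of `x` is set and all lower bits are clear, then
bit `k` of `x − 1` (hence of `clb x`) is clear. -/
theorem testBit_clb_low {x k : ℕ} (hk : x.testBit k = true) (hlow : ∀ i, i < k → x.testBit i = false) :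
    (clb x).testBit k = false := by
  -- x % 2^k = 0 and x / 2^k is odd, so x = 2^(k+1) * q + 2^k
  have hmod : x % 2 ^ k = 0 := by
    refine Nat.eq_of_testBit_eq fun i => ?_
    rw [Nat.testBit_mod_two_pow, Nat.zero_testBit]
    by_cases hi : i < k
    · simp [hi, hlow i hi]
    · simp [hi]
  set m := x / 2 ^ k with hm
  have hx : x = 2 ^ k * m := by
    have := Nat.div_add_mod x (2 ^ k)
    rw [hmod, Nat.add_zero] at this
    exact this.symm
  have hm1 : m % 2 = 1 := by
    have h1 : (2 ^ k * m).testBit k = true := by rw [← hx]; exact hk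
    rw [Nat.testBit_two_pow_mul] at h1
    simp only [ge_iff_le, le_refl, decide_true, Nat.sub_self, Nat.testBit_zero, Bool.true_and,
      decide_eq_true_eq] at h1
    exact h1
  have hx' : x = 2 ^ (k + 1) * (m / 2) + 2 ^ k := by
    have : m = 2 * (m / 2) + 1 := by omega
    rw [hx, Nat.pow_succ]
    conv_lhs => rw [this]
    ring
  have hsub : x - 1 = 2 ^ (k + 1) * (m / 2) + (2 ^ k - 1) := by
    have : 1 ≤ 2 ^ k := Nat.one_le_two_pow
    omega
  rw [clb, Nat.testBit_and, hsub, Nat.testBit_two_pow_mul_add _ (by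
    have : 2 ^ k < 2 ^ (k + 1) := Nat.pow_lt_pow_right (by norm_num) (Nat.lt_succ_self k)
    omega)]
  simp [Nat.testBit_two_pow_sub_one]

/-- Clearing the lowest set bit of a nonzero `x < 2^N` loses at least one bit below `N`:
`popc N (clb x) + 1 ≤ popc N x`. -/
theorem popc_clb_succ_le {N x : ℕ} (hx : x ≠ 0) (hxN : x < 2 ^ N) : popc N (clb x) + 1 ≤ popc N x := by
  classical
  -- the lowest set bit k of x
  have hex : ∃ i, x.testBit i = true := Nat.exists_testBit_of_ne_zero hx
  let k := Nat.find hex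
  have hk : x.testBit k = true := Nat.find_spec hex
  have hlow : ∀ i, i < k → x.testBit i = false := fun i hi => by
    have := Nat.find_min hex hi
    simpa using this
  have hkN : k < N := by
    by_contra hge
    rw [not_lt] at hge
    have := Nat.testBit_lt_two_pow (lt_of_lt_of_le hxN (Nat.pow_le_pow_right (by norm_num) hge))
    rw [hk] at this
    exact Bool.noConfusion this
  rw [popc_eq_sum, popc_eq_sum, Nat.add_one_le_iff]
  refine Finset.sum_lt_sum (fun i _ => ?_) ⟨⟨k, hkN⟩, Finset.mem_univ _, ?_⟩
  · -- pointwise: bits of clb x are bits of x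
    rcases Bool.eq_false_or_eq_true ((clb x).testBit i) with h | h
    · rw [h, testBit_of_testBit_clb h]
    · rw [h]; exact Nat.zero_le _
  · simp [testBit_clb_low hk hlow, hk]

/-- `clb x ≤ x`, so words stay below `2^N`. -/
theorem clb_lt_two_pow {N x : ℕ} (hxN : x < 2 ^ N) : clb x < 2 ^ N :=
  lt_of_le_of_lt Nat.and_le_left hxN

/-- **Soundness of `hasBits`**: `hasBits k x = true` and `x < 2^N` give `k ≤ popc N x` (at least `k` set bits
below `N`). -/
theorem le_popc_of_hasBits : ∀ (k : ℕ) {N x : ℕ}, hasBits k x = true → x < 2 ^ N → k ≤ popc N x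
  | 0, _, _, _, _ => Nat.zero_le _
  | k + 1, N, x, h, hxN => by
    rw [hasBits, Bool.and_eq_true, Bool.not_eq_true', beq_eq_false_iff_ne] at h
    exact le_trans (Nat.succ_le_succ (le_popc_of_hasBits k h.2 (clb_lt_two_pow hxN))) (popc_clb_succ_le h.1 hxN)

/-- `hasBits 6`, unrolled: the same Boolean with no recursion on the count (≈ 1.6× faster under `decide +kernel`,
qec-search-7 2026-08-26: 113k-word chunk 66 s vs 108 s). (definition) -/
def hasBits6 (x : ℕ) : Bool :=
  !(x == 0) && (!(clb x == 0) && (!(clb (clb x) == 0) && (!(clb (clb (clb x)) == 0) &&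
    (!(clb (clb (clb (clb x))) == 0) && (!(clb (clb (clb (clb (clb x)))) == 0) && true)))))

/-- `hasBits6` is `hasBits 6`. -/
theorem hasBits6_eq (x : ℕ) : hasBits6 x = hasBits 6 x := rfl

/-- Soundness of `hasBits6`. -/
theorem le_popc_of_hasBits6 {N x : ℕ} (h : hasBits6 x = true) (hxN : x < 2 ^ N) : 6 ≤ popc N x :=
  le_popc_of_hasBits 6 (hasBits6_eq x ▸ h) hxN

end HasBits

/-! ## The enumeration of short XORs -/

/-- `dfs test gens b acc`: for every sub-list `S` of `gens` with `1 ≤ |S| ≤ b + 1`, `test (acc ⊕ ⨁ S)`;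
include/skip recursion, structural on `gens` (the budget `b` counts FURTHER elements after the first). -/
def dfs (test : ℕ → Bool) : List ℕ → ℕ → ℕ → Bool
  | [], _, _ => true
  | g :: gs, 0, acc => test (acc ^^^ g) && dfs test gs 0 acc
  | g :: gs, b + 1, acc => (test (acc ^^^ g) && dfs test gs b (acc ^^^ g)) && dfs test gs (b + 1) acc

/-- What a passing enumeration establishes: `test (acc ⊕ ⨁ S)` for every nonempty sub-list `S` of `gens` of length
`≤ b + 1`. -/
def DReaches (test : ℕ → Bool) (gens : List ℕ) (b acc : ℕ) : Prop :=
  ∀ S : List ℕ, S.Sublist gens → S ≠ [] → S.length ≤ b + 1 → test (acc ^^^ xorList S) = true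

section Dfs

variable {test : ℕ → Bool}

/-- `xorList` of a singleton. -/
theorem xorList_singleton (g : ℕ) : xorList [g] = g := by
  rw [xorList, xorList, Nat.xor_zero]

/-- **Completeness of `dfs`.** -/
theorem dfs_sublist : ∀ (gens : List ℕ) (b acc : ℕ), dfs test gens b acc = true → DReaches test gens b acc := by
  intro gens
  induction gens with
  | nil =>
    intro b acc _ S hS hne _
    exact absurd (List.sublist_nil.mp hS) hne
  | cons g gs ih =>
    intro b acc h S hS hne hlen
    -- the three facts a passing node provides (the middle one only for positive budget)
    have h1 : test (acc ^^^ g) = true := by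
      cases b <;> simp only [dfs, Bool.and_eq_true] at h
      · exact h.1
      · exact h.1.1
    have h3 : dfs test gs b acc = true := by
      cases b <;> simp only [dfs, Bool.and_eq_true] at h
      · exact h.2
      · exact h.2
    rcases hS with _ | ⟨_, hS'⟩ | ⟨_, hS'⟩
    · exact ih b acc h3 S hS' hne hlen
    · rename_i S'
      by_cases hS'e : S' = []
      · subst hS'e
        rw [xorList_singleton]
        exact h1
      · cases b with
        | zero =>
          rw [List.length_cons] at hlen
          have : S'.length = 0 := by omega
          exact absurd (List.eq_nil_of_length_eq_zero this) hS'e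
        | succ b' =>
          rw [List.length_cons] at hlen
          have hlen' : S'.length ≤ b' + 1 := by omega
          have h2 : dfs test gs b' (acc ^^^ g) = true := by
            simp only [dfs, Bool.and_eq_true] at h
            exact h.1.2
          have := ih b' (acc ^^^ g) h2 S' hS' hS'e hlen'
          rw [xorList, ← Nat.xor_assoc]
          exact this

/-- `DReaches` is antitone in the budget. -/
theorem DReaches.mono {gens : List ℕ} {b b' acc : ℕ} (hb : b ≤ b') (h : DReaches test gens b' acc) :
    DReaches test gens b acc :=
  fun S hS hne hlen => h S hS hne (le_trans hlen (Nat.succ_le_succ hb))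

/-- Chunk `i` of the enumeration from the origin with total budget `b + 2` elements: the sub-lists whose first
element is `gens[i]` — the singleton, and `gens[i] ⊕ ⨁ S'` for the nonempty sub-lists `S'` of the later generators
with `|S'| ≤ b + 1`. One kernel evaluation per chunk. (definition) -/
def ichunk (test : ℕ → Bool) (gens : List ℕ) (b i : ℕ) : Bool :=
  test (gens.getD i 0) && dfs test (gens.drop (i + 1)) b (gens.getD i 0)

/-- In range, `getD` is `getElem`. -/
private theorem getD_eq_getElem_of_lt' (l : List ℕ) {k : ℕ} (hk : k < l.length) : l.getD k 0 = l[k] := by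
  rw [List.getD_eq_getElem?_getD, List.getElem?_eq_getElem hk, Option.getD_some]

/-- **Chunking by the first selected generator**: if every chunk `i < |gens|` passes with budget `b`, the
enumeration from the origin (`acc = 0`) reaches every nonempty sub-list of length `≤ b + 2`. The length is taken as
a numeral `m`. -/
theorem dreaches_of_ichunks (m : ℕ) :
    ∀ (gens : List ℕ) (b : ℕ), gens.length = m → (∀ i, i < m → ichunk test gens b i = true) →
      DReaches test gens (b + 1) 0 := by
  intro gens
  induction gens generalizing m with
  | nil =>
    intro b _ _ S hS hne _
    exact absurd (List.sublist_nil.mp hS) hne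
  | cons g gs ih =>
    intro b hm hch S hS hne hlen
    rw [List.length_cons] at hm
    have hm' : gs.length = m - 1 := by omega
    have hmpos : 0 < m := by omega
    rcases hS with _ | ⟨_, hS'⟩ | ⟨_, hS'⟩
    · refine ih (m - 1) b hm' (fun i hi => ?_) S hS' hne hlen
      have := hch (i + 1) (by omega)
      simpa [ichunk] using this
    · rename_i S'
      have h0 := hch 0 hmpos
      simp only [ichunk, List.getD_cons_zero, List.drop_succ_cons, List.drop_zero, Bool.and_eq_true] at h0
      rw [Nat.zero_xor, xorList]
      by_cases hS'e : S' = []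
      · subst hS'e
        rw [xorList, Nat.xor_zero]
        exact h0.1
      · rw [List.length_cons] at hlen
        have hlen' : S'.length ≤ b + 1 := by omega
        exact dfs_sublist gs b g h0.2 S' hS' hS'e hlen'

end Dfs

/-! ## The reduced-row-echelon certificate and the kernel basis, as words -/

/-- `pivotsOK n piv red`: `|piv| = |red|`, every pivot column is `< n`, and column `piv[i]` of the reduced rows is
the unit vector `e_i` (read as the column word `colMask red piv[i] = 2^i`). (definition) -/
def pivotsOK (n : ℕ) (piv red : List ℕ) : Bool :=
  (piv.length == red.length) &&
    (List.range piv.length).all fun i => (piv.getD i 0 < n : Bool) && (colMask red (piv.getD i 0) == 2 ^ i)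

/-- `combOK H red comb`: `|comb| = |red|` and reduced row `i` is the XOR of the rows of `H` listed in `comb[i]`
(so every reduced row lies in the row space of `H`). (definition) -/
def combOK (H red : List ℕ) (comb : List (List ℕ)) : Bool :=
  (comb.length == red.length) &&
    (List.range red.length).all fun i => xorRows H (comb.getD i []) == red.getD i 0

/-- The indices `i` of the reduced rows having a `1` in column `j`. (definition) -/
def pivSelIdx (red : List ℕ) (j : ℕ) : List ℕ :=
  (List.range red.length).filter fun i => (red.getD i 0).testBit j

/-- The pivot part of the kernel basis vector of column `j`: `⨁ {2^(piv[i]) : red[i][j] = 1}`. (definition) -/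
def pivPart (piv red : List ℕ) (j : ℕ) : ℕ :=
  xorList ((pivSelIdx red j).map fun i => 2 ^ piv.getD i 0)

/-- The kernel basis vector of (free) column `j`: `γ_j = e_j ⊕ ⨁ {e_(piv[i]) : red[i][j] = 1}`, as a word.
(definition) -/
def kerVec (piv red : List ℕ) (j : ℕ) : ℕ := 2 ^ j ^^^ pivPart piv red j

/-- The free columns: `j < n` not among the pivots, increasing. (definition) -/
def freeIdx (n : ℕ) (piv : List ℕ) : List ℕ := (List.range n).filter fun j => !(piv.elem j)

/-- The standard kernel basis of the reduced system, one word per free column. (definition) -/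
def kerBasis (n : ℕ) (piv red : List ℕ) : List ℕ := (freeIdx n piv).map (kerVec piv red)

/-- The information-set certificate of one side: pivots, reduced rows, and their row decompositions over the
syndrome matrix. Mirrors CERT-FORMAT v1 §5.3 (`bz`, one block `G₁ = A·H_syn` systematic on `T = piv`) restricted
to the label-free case. -/
structure InfoSetCert where
  /-- pivot columns `p_0 … p_{r−1}` (qubit indices) -/
  piv : List ℕ
  /-- reduced rows `ρ_0 … ρ_{r−1}` (words; `ρ_i[p_{i'}] = [i = i']`) -/
  red : List ℕ
  /-- `comb[i]` = indices of the rows of the syndrome matrix XOR-ing to `ρ_i` -/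
  comb : List (List ℕ)

/-- **The information-set lower-bound check of one side, monolithic form**: the RREF certificate checks against the
syndrome rows `Hsyn`, and every XOR of between `1` and `wmax` kernel-basis words has at least `wmax + 1` set bits.
For the chunked form use `infoSetStructOK` + `ichunk (hasBits (wmax + 1)) (kerBasis n piv red) (wmax − 2) i`.
(definition) -/
def infoSetLowerOK (n : ℕ) (Hsyn : List ℕ) (c : InfoSetCert) (wmax : ℕ) : Bool :=
  pivotsOK n c.piv c.red && combOK Hsyn c.red c.comb &&
    dfs (hasBits (wmax + 1)) (kerBasis n c.piv c.red) (wmax - 1) 0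

/-- The structural part of the information-set check (no enumeration). (definition) -/
def infoSetStructOK (n : ℕ) (Hsyn : List ℕ) (c : InfoSetCert) : Bool :=
  pivotsOK n c.piv c.red && combOK Hsyn c.red c.comb

end Summit.Ventures.QEC.Census
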